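import Summits.ValiantsHypothesis.ValiantsHypothesis.Theorems.LacunarySymmetroidMatrixDescartesDoorA26WallBubblingOnePairWallClosure
import Summits.ValiantsHypothesis.ValiantsHypothesis.Theorems.LacunarySymmetroidMatrixDescartesDoorA26WallBubblingTwoPairWallRelations

/-!
# Wall bubbling for `DoorA26` — THE WALL STRATUM `Stmt.weylFaces_wall` REDUCED TO THE TWO-PAIR CHAINS (bookkeeping, door-free)

HONEST FRAMING.  Obligation (W) `stub_weylFaces` of `Cruxes/DoorA26/Lines/wall_bubbling.lean` (crux `DoorA26`, stmt-ValiantsHypothesis-19979; OPEN,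
typed, never asserted); statement file `Cruxes/DoorA26/Lines/wall_bubbling_ConfluentDoor.lean` rev 5d,
`Stmt.weylFaces_wall := ∀ δ ∈ SortedSimplex, HasWeylCoincidence δ → ¬ HasMixedCoincidence δ → ¬ IsValueGeneric δ → δ ∉ closure TwentyLocus`.
W1 seat val-sym-door-p2 g13 (#43).  W1 #42 (`…OnePairWallClosure`) proved the ONE-PAIR part outright.  THIS FILE shows, kernel-checked, that NOTHING ELSE
than the two-pair tight chains remains: **`weylFaces_wall_of_twoPairChains (hC1) (hC2) : <Stmt.weylFaces_wall with the rev-5d predicates inlined verbatim>`**,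
where `hC1`, `hC2` are the sequence-currency statements «no sequence of genuine `(2,6)` pencils with twenty log-zeros at every stage has exponents converging to
a two-Weyl-pair point (`δ0 5 = δ0 0`, `δ0 4 = δ0 1`) on the wall (c1) `δ0 0 + δ0 1 = δ0 2 + δ0 3`, resp. (c2) `δ0 0 + δ0 2 = δ0 1 + δ0 3`, generic otherwise
(`hgen` as in W1 #26d/#26b/#28)» — literally the two-pair analogues of W1 #41 `onePairWallA_noTwenties`, i.e. what a two-dslope run of W2's chain
would prove (its single-cluster branch is W1 #28; the wall (c3) `δ0 0 + δ0 3 = δ0 1 + δ0 2` is (c2) after swapping the positions `2, 3`, so no third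
hypothesis is needed).

PROOF (bookkeeping): `by_cases honePair` → W1 #42; else two DISJOINT pairs `{i,j}, {k,l}` (a shared letter is a triple = a MIXED coincidence); the fifth and
sixth letters by counting; the non-generic relation has four distinct values, is moved off `j, l`, then involves `i` and `k` (pigeonhole), and after
normalising (`a = i`) is (c1) `k = b` or (c2) `k ∈ {c, d}`; the relabelling `g = ![i, k, ·, ·, l, j]` is injective (`injective_vec6`), sums are reindexed
(`Fintype.sum_bijective`), the four relabelled values are distinct without three-term relation, so W1 #43a `relClass_twoPairWallC1/C2` (uniqueness of the
relation among four such reals) supply `hgen`, and `hC1`/`hC2` end it.  Three pairs never occur here (four distinct values exist).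

So: `Stmt.weylFaces_wall` ⟸ (c1)-chain ∧ (c2)-chain, door-free; both chains OPEN (need two-dslope rungs; arithmetic W1 #38, hcount W1 #37, per-cluster
limit W1 #27, non-degeneracy W1 #26b–d are in the tree).  Registers unchanged; (W), `ConfluentDoor26`, `NoTightChain26(NC)`, `DoorA26` 19979, 18050 OPEN, typed
never asserted; nothing on VP ≠ VNP.  Def-free.  `--supports stmt-ValiantsHypothesis-19979 --as helper`.
-/

-- `Summit.ValiantsHypothesis.ValiantsHypothesis.…` repeats a component by the D-0017 layout
-- (single-conjunct summit), which the `dupNamespace` linter flags; the name is mandated.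
set_option linter.dupNamespace false

namespace Summit.ValiantsHypothesis.ValiantsHypothesis.Theorems.LacunarySymmetroidMatrixDescartes.WallBubbling

open Finset Filter Topology
open Bubbling (polar TwentyLocus SortedSimplex)
open scoped BigOperators

/-! ## 1. The relabelled two-pair chain run (the uniqueness of the relation is W1 #43a `…TwoPairWallRelations`) -/

/-- **Relabelled two-pair chain run.**  Given the two chain statements, exponents `δseq → δ`, genuine pencils with twenty log-zeros, and an injective
relabelling `g` with `δ (g 5) = δ (g 0)`, `δ (g 4) = δ (g 1)`, the four values `δ (g 0..3)` pairwise distinct without three-term relation and the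
relation in normal position (c1) or (c2): impossible. [this work] -/
theorem twoPairWall_noTwenties_relabelled
    (hC1 : ∀ (δs : ℕ → Fin 6 → ℝ) (δ0 : Fin 6 → ℝ), (∀ l, Tendsto (fun ν => δs ν l) atTop (𝓝 (δ0 l))) →
      δ0 5 = δ0 0 → δ0 4 = δ0 1 → δ0 0 + δ0 1 = δ0 2 + δ0 3 →
      (∀ a b c e : Fin 4, δ0 a.castSucc.castSucc + δ0 b.castSucc.castSucc = δ0 c.castSucc.castSucc + δ0 e.castSucc.castSucc →
        (a = c ∧ b = e) ∨ (a = e ∧ b = c) ∨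
          (((a = 0 ∧ b = 1) ∨ (a = 1 ∧ b = 0)) ∧ ((c = 2 ∧ e = 3) ∨ (c = 3 ∧ e = 2))) ∨
          (((a = 2 ∧ b = 3) ∨ (a = 3 ∧ b = 2)) ∧ ((c = 0 ∧ e = 1) ∨ (c = 1 ∧ e = 0)))) →
      ∀ (U : ℕ → Fin 6 → Matrix (Fin 2) (Fin 2) ℝ), (∀ ν l, (U ν l).IsSymm) →
      (∀ ν, ∃ t, (∑ l, Real.exp (δs ν l * t) • U ν l).det ≠ 0) →
      ∀ (z : ℕ → Fin 20 → ℝ), (∀ ν, StrictMono (z ν)) → (∀ ν i, (∑ l, Real.exp (δs ν l * z ν i) • U ν l).det = 0) → False)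
    (hC2 : ∀ (δs : ℕ → Fin 6 → ℝ) (δ0 : Fin 6 → ℝ), (∀ l, Tendsto (fun ν => δs ν l) atTop (𝓝 (δ0 l))) →
      δ0 5 = δ0 0 → δ0 4 = δ0 1 → δ0 0 + δ0 2 = δ0 1 + δ0 3 →
      (∀ a b c e : Fin 4, δ0 a.castSucc.castSucc + δ0 b.castSucc.castSucc = δ0 c.castSucc.castSucc + δ0 e.castSucc.castSucc →
        (a = c ∧ b = e) ∨ (a = e ∧ b = c) ∨
          (((a = 0 ∧ b = 2) ∨ (a = 2 ∧ b = 0)) ∧ ((c = 1 ∧ e = 3) ∨ (c = 3 ∧ e = 1))) ∨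
          (((a = 1 ∧ b = 3) ∨ (a = 3 ∧ b = 1)) ∧ ((c = 0 ∧ e = 2) ∨ (c = 2 ∧ e = 0)))) →
      ∀ (U : ℕ → Fin 6 → Matrix (Fin 2) (Fin 2) ℝ), (∀ ν l, (U ν l).IsSymm) →
      (∀ ν, ∃ t, (∑ l, Real.exp (δs ν l * t) • U ν l).det ≠ 0) →
      ∀ (z : ℕ → Fin 20 → ℝ), (∀ ν, StrictMono (z ν)) → (∀ ν i, (∑ l, Real.exp (δs ν l * z ν i) • U ν l).det = 0) → False)
    (δseq : ℕ → Fin 6 → ℝ) (δ : Fin 6 → ℝ)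
    (hδ : ∀ l, Tendsto (fun ν => δseq ν l) atTop (𝓝 (δ l)))
    (S : ℕ → Fin 6 → Matrix (Fin 2) (Fin 2) ℝ) (hS : ∀ ν l, (S ν l).IsSymm)
    (hneS : ∀ ν, ∃ t, (∑ l, Real.exp (δseq ν l * t) • S ν l).det ≠ 0)
    (z : ℕ → Fin 20 → ℝ) (hz : ∀ ν, StrictMono (z ν)) (hroot : ∀ ν i, (∑ l, Real.exp (δseq ν l * z ν i) • S ν l).det = 0)
    (g : Fin 6 → Fin 6) (hg : Function.Injective g) (h50 : δ (g 5) = δ (g 0)) (h41 : δ (g 4) = δ (g 1))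
    (hinj : ∀ a b : Fin 4, δ (g a.castSucc.castSucc) = δ (g b.castSucc.castSucc) → a = b)
    (hnoAP : ∀ x y w : Fin 4, x ≠ y → x ≠ w → y ≠ w →
      2 * δ (g x.castSucc.castSucc) ≠ δ (g y.castSucc.castSucc) + δ (g w.castSucc.castSucc))
    (hrel : δ (g 0) + δ (g 1) = δ (g 2) + δ (g 3) ∨ δ (g 0) + δ (g 2) = δ (g 1) + δ (g 3)) : False := by
  classical
  have hbij : Function.Bijective g := Finite.injective_iff_bijective.mp hg
  have hsumg : ∀ F : Fin 6 → Matrix (Fin 2) (Fin 2) ℝ, ∑ k, F (g k) = ∑ l, F l :=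
    fun F => Fintype.sum_bijective g hbij (fun k => F (g k)) F (fun _ => rfl)
  have hne' : ∀ ν, ∃ t, (∑ k, Real.exp (δseq ν (g k) * t) • S ν (g k)).det ≠ 0 := by
    intro ν
    obtain ⟨t, ht⟩ := hneS ν
    exact ⟨t, by rw [hsumg (fun l => Real.exp (δseq ν l * t) • S ν l)]; exact ht⟩
  have hroot' : ∀ ν i, (∑ k, Real.exp (δseq ν (g k) * z ν i) • S ν (g k)).det = 0 := by
    intro ν i
    rw [hsumg (fun l => Real.exp (δseq ν l * z ν i) • S ν l)]
    exact hroot ν i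
  rcases hrel with h1 | h2
  · exact hC1 (fun ν k => δseq ν (g k)) (fun k => δ (g k)) (fun k => hδ (g k)) h50 h41 h1
      (relClass_twoPairWallC1 (fun m => δ (g m.castSucc.castSucc)) hinj hnoAP h1)
      (fun ν k => S ν (g k)) (fun ν k => hS ν (g k)) hne' z hz hroot'
  · exact hC2 (fun ν k => δseq ν (g k)) (fun k => δ (g k)) (fun k => hδ (g k)) h50 h41 h2
      (relClass_twoPairWallC2 (fun m => δ (g m.castSucc.castSucc)) hinj hnoAP h2)
      (fun ν k => S ν (g k)) (fun ν k => hS ν (g k)) hne' z hz hroot'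

/-! ## 2. The reduction -/

/-- **`Stmt.weylFaces_wall` REDUCES TO THE TWO TWO-PAIR CHAINS** (rev-5d predicates inlined verbatim; `SortedSimplex`, `TwentyLocus` the Theorems-side
copies).  The one-pair part is W1 #42; the rest is bookkeeping, see the module docstring. [this work] -/
theorem weylFaces_wall_of_twoPairChains
    (hC1 : ∀ (δs : ℕ → Fin 6 → ℝ) (δ0 : Fin 6 → ℝ), (∀ l, Tendsto (fun ν => δs ν l) atTop (𝓝 (δ0 l))) →
      δ0 5 = δ0 0 → δ0 4 = δ0 1 → δ0 0 + δ0 1 = δ0 2 + δ0 3 →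
      (∀ a b c e : Fin 4, δ0 a.castSucc.castSucc + δ0 b.castSucc.castSucc = δ0 c.castSucc.castSucc + δ0 e.castSucc.castSucc →
        (a = c ∧ b = e) ∨ (a = e ∧ b = c) ∨
          (((a = 0 ∧ b = 1) ∨ (a = 1 ∧ b = 0)) ∧ ((c = 2 ∧ e = 3) ∨ (c = 3 ∧ e = 2))) ∨
          (((a = 2 ∧ b = 3) ∨ (a = 3 ∧ b = 2)) ∧ ((c = 0 ∧ e = 1) ∨ (c = 1 ∧ e = 0)))) →
      ∀ (U : ℕ → Fin 6 → Matrix (Fin 2) (Fin 2) ℝ), (∀ ν l, (U ν l).IsSymm) →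
      (∀ ν, ∃ t, (∑ l, Real.exp (δs ν l * t) • U ν l).det ≠ 0) →
      ∀ (z : ℕ → Fin 20 → ℝ), (∀ ν, StrictMono (z ν)) → (∀ ν i, (∑ l, Real.exp (δs ν l * z ν i) • U ν l).det = 0) → False)
    (hC2 : ∀ (δs : ℕ → Fin 6 → ℝ) (δ0 : Fin 6 → ℝ), (∀ l, Tendsto (fun ν => δs ν l) atTop (𝓝 (δ0 l))) →
      δ0 5 = δ0 0 → δ0 4 = δ0 1 → δ0 0 + δ0 2 = δ0 1 + δ0 3 →
      (∀ a b c e : Fin 4, δ0 a.castSucc.castSucc + δ0 b.castSucc.castSucc = δ0 c.castSucc.castSucc + δ0 e.castSucc.castSucc →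
        (a = c ∧ b = e) ∨ (a = e ∧ b = c) ∨
          (((a = 0 ∧ b = 2) ∨ (a = 2 ∧ b = 0)) ∧ ((c = 1 ∧ e = 3) ∨ (c = 3 ∧ e = 1))) ∨
          (((a = 1 ∧ b = 3) ∨ (a = 3 ∧ b = 1)) ∧ ((c = 0 ∧ e = 2) ∨ (c = 2 ∧ e = 0)))) →
      ∀ (U : ℕ → Fin 6 → Matrix (Fin 2) (Fin 2) ℝ), (∀ ν l, (U ν l).IsSymm) →
      (∀ ν, ∃ t, (∑ l, Real.exp (δs ν l * t) • U ν l).det ≠ 0) →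
      ∀ (z : ℕ → Fin 20 → ℝ), (∀ ν, StrictMono (z ν)) → (∀ ν i, (∑ l, Real.exp (δs ν l * z ν i) • U ν l).det = 0) → False) :
    ∀ δ ∈ SortedSimplex, (∃ i j : Fin 6, i ≠ j ∧ δ i = δ j) →
      ¬ (∃ i k l : Fin 6, i ≠ k ∧ i ≠ l ∧ k ≠ l ∧ 2 * δ i = δ k + δ l) →
      ¬ (∀ a b c d : Fin 6, δ a + δ b = δ c + δ d → (δ a = δ c ∧ δ b = δ d) ∨ (δ a = δ d ∧ δ b = δ c)) →
      δ ∉ closure TwentyLocus := by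
  intro δ hδS hW hM hV
  by_cases hone : ∀ i j k l : Fin 6, i ≠ j → δ i = δ j → k ≠ l → δ k = δ l → k = i ∨ k = j
  · exact not_mem_closure_twentyLocus_onePairWall δ hδS hW hM hV hone
  intro hcl
  classical
  have hM' : ∀ a k l : Fin 6, a ≠ k → a ≠ l → k ≠ l → 2 * δ a ≠ δ k + δ l :=
    fun a k l hak hal hkl h => hM ⟨a, k, l, hak, hal, hkl, h⟩
  -- (0) entrance
  obtain ⟨δseq, hmem, hlim⟩ := mem_closure_iff_seq_limit.mp hcl
  choose S hS hneS z hz hroot using fun ν => twenty_log_zeros_of_mem_twentyLocus (hmem ν)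
  have hδ : ∀ l, Tendsto (fun ν => δseq ν l) atTop (𝓝 (δ l)) := fun l => (tendsto_pi_nhds.mp hlim) l
  -- (1) two disjoint pairs `{i, j}`, `{k, l}` with distinct values
  push Not at hone
  obtain ⟨i, j, k, l, hij, hδij, hkl, hδkl, hki, hkj⟩ := hone
  have hli : l ≠ i := fun h => hM' k i j hki hkj hij (by rw [h] at hδkl; linarith)
  have hlj : l ≠ j := fun h => hM' k i j hki hkj hij (by rw [h] at hδkl; linarith)
  have hvik : δ i ≠ δ k := fun h => hM' k i j hki hkj hij (by linarith)
  -- (2) the fifth and sixth letters; every letter is one of the six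
  obtain ⟨m, hm⟩ : ∃ m : Fin 6, m ∉ ({i, j, k, l} : Finset (Fin 6)) := by
    have hlt : ({i, j, k, l} : Finset (Fin 6)).card < (Finset.univ : Finset (Fin 6)).card :=
      lt_of_le_of_lt Finset.card_le_four (by rw [Finset.card_univ, Fintype.card_fin]; norm_num)
    obtain ⟨m, -, hm⟩ := Finset.exists_mem_notMem_of_card_lt_card hlt
    exact ⟨m, hm⟩
  obtain ⟨n, hn⟩ : ∃ n : Fin 6, n ∉ ({i, j, k, l, m} : Finset (Fin 6)) := by
    have hlt : ({i, j, k, l, m} : Finset (Fin 6)).card < (Finset.univ : Finset (Fin 6)).card :=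
      lt_of_le_of_lt Finset.card_le_five (by rw [Finset.card_univ, Fintype.card_fin]; norm_num)
    obtain ⟨n, -, hn⟩ := Finset.exists_mem_notMem_of_card_lt_card hlt
    exact ⟨n, hn⟩
  simp only [Finset.mem_insert, Finset.mem_singleton, not_or] at hm hn
  obtain ⟨hmi, hmj, hmk, hml⟩ := hm
  obtain ⟨hni, hnj, hnk, hnl, hnm⟩ := hn
  have huniv : ∀ x : Fin 6, x = i ∨ x = j ∨ x = k ∨ x = l ∨ x = m ∨ x = n := by
    have hcard : ({i, j, k, l, m, n} : Finset (Fin 6)).card = 6 := by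
      rw [Finset.card_insert_of_notMem, Finset.card_insert_of_notMem, Finset.card_insert_of_notMem,
        Finset.card_insert_of_notMem, Finset.card_insert_of_notMem, Finset.card_singleton]
      · simp only [Finset.mem_singleton]; exact fun h => hnm h.symm
      · simp only [Finset.mem_insert, Finset.mem_singleton, not_or]; exact ⟨fun h => hml h.symm, fun h => hnl h.symm⟩
      · simp only [Finset.mem_insert, Finset.mem_singleton, not_or]; exact ⟨hkl, fun h => hmk h.symm, fun h => hnk h.symm⟩
      · simp only [Finset.mem_insert, Finset.mem_singleton, not_or]
        exact ⟨(Ne.symm hkj), (Ne.symm hlj), fun h => hmj h.symm, fun h => hnj h.symm⟩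
      · simp only [Finset.mem_insert, Finset.mem_singleton, not_or]
        exact ⟨hij, (Ne.symm hki), (Ne.symm hli), fun h => hmi h.symm, fun h => hni h.symm⟩
    have huniv' := Finset.eq_univ_of_card ({i, j, k, l, m, n} : Finset (Fin 6)) (by rw [hcard, Fintype.card_fin])
    intro x
    have hx := Finset.mem_univ x
    rw [← huniv'] at hx
    simpa only [Finset.mem_insert, Finset.mem_singleton] using hx
  -- (3) the non-generic relation, moved off `j` and `l`, with four distinct values
  push Not at hV
  obtain ⟨a0, b0, c0, d0, hsum0, hn10, hn20⟩ := hV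
  have hoff : ∀ x : Fin 6, ∃ x' : Fin 6, x' ≠ j ∧ x' ≠ l ∧ δ x' = δ x := by
    intro x
    by_cases hx : x = j
    · exact ⟨i, hij, Ne.symm hli, by rw [hx, hδij]⟩
    by_cases hx' : x = l
    · exact ⟨k, hkj, hkl, by rw [hx', hδkl]⟩
    exact ⟨x, hx, hx', rfl⟩
  obtain ⟨a, haj, hal, ha⟩ := hoff a0
  obtain ⟨b, hbj, hbl, hb⟩ := hoff b0
  obtain ⟨c, hcj, hcl', hc⟩ := hoff c0
  obtain ⟨d, hdj, hdl, hd⟩ := hoff d0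
  have hsum : δ a + δ b = δ c + δ d := by rw [ha, hb, hc, hd]; exact hsum0
  have hn1 : δ a = δ c → δ b ≠ δ d := by rw [ha, hb, hc, hd]; exact hn10
  have hn2 : δ a = δ d → δ b ≠ δ c := by rw [ha, hb, hc, hd]; exact hn20
  have hac : δ a ≠ δ c := fun h => hn1 h (by linarith)
  have had : δ a ≠ δ d := fun h => hn2 h (by linarith)
  have hbd : δ b ≠ δ d := fun h => hac (by linarith)
  have hbc : δ b ≠ δ c := fun h => had (by linarith)
  have hab : δ a ≠ δ b := by
    intro h
    have hcd : c ≠ d := fun hcd => by subst hcd; exact hac (by linarith)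
    exact hM' a c d (ne_of_apply_ne δ hac) (ne_of_apply_ne δ had) hcd (by linarith)
  have hcd : δ c ≠ δ d := by
    intro h
    exact hM' c a b (ne_of_apply_ne δ hac.symm) (ne_of_apply_ne δ hbc.symm) (ne_of_apply_ne δ hab) (by linarith)
  -- letters off `j, l` are among `i, k, m, n`
  have hmem : ∀ x : Fin 6, x ≠ j → x ≠ l → x = i ∨ x = k ∨ x = m ∨ x = n := by
    intro x hxj hxl
    rcases huniv x with h | h | h | h | h | h
    · exact Or.inl h
    · exact absurd h hxj
    · exact Or.inr (Or.inl h)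
    · exact absurd h hxl
    · exact Or.inr (Or.inr (Or.inl h))
    · exact Or.inr (Or.inr (Or.inr h))
  -- (4) the common end: injective relabelling, pairs at `0,5` and `1,4`, relation (c1) or (c2)
  have common : ∀ g : Fin 6 → Fin 6, Function.Injective g → g 0 = i → g 5 = j → g 1 = k → g 4 = l →
      δ (g 0) ≠ δ (g 1) → δ (g 0) ≠ δ (g 2) → δ (g 0) ≠ δ (g 3) → δ (g 1) ≠ δ (g 2) → δ (g 1) ≠ δ (g 3) → δ (g 2) ≠ δ (g 3) →
      (δ (g 0) + δ (g 1) = δ (g 2) + δ (g 3) ∨ δ (g 0) + δ (g 2) = δ (g 1) + δ (g 3)) → False := by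
    intro g hg hg0 hg5 hg1 hg4 h01 h02 h03 h12 h13 h23 hrel
    have h4 : ∀ x : Fin 4, x = 0 ∨ x = 1 ∨ x = 2 ∨ x = 3 := by decide
    have hinj : ∀ x y : Fin 4, δ (g x.castSucc.castSucc) = δ (g y.castSucc.castSucc) → x = y := by
      intro x y hxy
      rcases h4 x with rfl | rfl | rfl | rfl <;> rcases h4 y with rfl | rfl | rfl | rfl
      all_goals first
        | rfl
        | exact absurd hxy h01 | exact absurd hxy.symm h01 | exact absurd hxy h02 | exact absurd hxy.symm h02
        | exact absurd hxy h03 | exact absurd hxy.symm h03 | exact absurd hxy h12 | exact absurd hxy.symm h12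
        | exact absurd hxy h13 | exact absurd hxy.symm h13 | exact absurd hxy h23 | exact absurd hxy.symm h23
    have hnoAP : ∀ x y w : Fin 4, x ≠ y → x ≠ w → y ≠ w →
        2 * δ (g x.castSucc.castSucc) ≠ δ (g y.castSucc.castSucc) + δ (g w.castSucc.castSucc) := by
      intro x y w hxy hxw hyw
      refine hM' _ _ _ ?_ ?_ ?_
      · exact fun h => hxy (Fin.castSucc_injective _ (Fin.castSucc_injective _ (hg h)))
      · exact fun h => hxw (Fin.castSucc_injective _ (Fin.castSucc_injective _ (hg h)))
      · exact fun h => hyw (Fin.castSucc_injective _ (Fin.castSucc_injective _ (hg h)))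
    have h50 : δ (g 5) = δ (g 0) := by rw [hg5, hg0, hδij]
    have h41 : δ (g 4) = δ (g 1) := by rw [hg4, hg1, hδkl]
    exact twoPairWall_noTwenties_relabelled hC1 hC2 δseq δ hδ S hS hneS z hz hroot g hg h50 h41 hinj hnoAP hrel
  -- (5) normalised finish: `a = i`; then `k = b` (c1), `k = c` or `k = d` (c2), else `b, c, d ∈ {m, n}` — impossible
  have finish : ∀ b c d : Fin 6, b ≠ j → b ≠ l → c ≠ j → c ≠ l → d ≠ j → d ≠ l →
      δ i ≠ δ b → δ i ≠ δ c → δ i ≠ δ d → δ b ≠ δ c → δ b ≠ δ d → δ c ≠ δ d →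
      δ i + δ b = δ c + δ d → False := by
    intro b c d hbj hbl hcj hcl' hdj hdl hib hic hid hbc hbd hcd hsum
    have hbi : b ≠ i := fun h => hib (by rw [h])
    have hci : c ≠ i := fun h => hic (by rw [h])
    have hdi : d ≠ i := fun h => hid (by rw [h])
    by_cases hbk : b = k
    · -- (c1): pairs `i, k` on one side
      subst hbk
      exact common ![i, b, c, d, l, j]
        (injective_vec6 i b c d l j (Ne.symm hbi) (Ne.symm hci) (Ne.symm hdi) (Ne.symm hli) hij (ne_of_apply_ne δ hbc)
          (ne_of_apply_ne δ hbd) hkl hbj (ne_of_apply_ne δ hcd) hcl' hcj hdl hdj hlj)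
        rfl rfl rfl rfl hib hic hid hbc hbd hcd (Or.inl hsum)
    by_cases hck : c = k
    · -- (c2): `i + b = k + d`
      subst hck
      exact common ![i, c, b, d, l, j]
        (injective_vec6 i c b d l j (Ne.symm hci) (Ne.symm hbi) (Ne.symm hdi) (Ne.symm hli) hij (ne_of_apply_ne δ hbc.symm)
          (ne_of_apply_ne δ hcd) hkl hcj (ne_of_apply_ne δ hbd) hbl hbj hdl hdj hlj)
        rfl rfl rfl rfl hic hib hid hbc.symm hcd hbd (Or.inr hsum)
    by_cases hdk : d = k
    · -- (c2) after `c ↔ d`: `i + b = k + c`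
      subst hdk
      have hsum' : δ i + δ b = δ d + δ c := by rw [hsum, add_comm]
      exact common ![i, d, b, c, l, j]
        (injective_vec6 i d b c l j (Ne.symm hdi) (Ne.symm hbi) (Ne.symm hci) (Ne.symm hli) hij (ne_of_apply_ne δ hbd.symm)
          (ne_of_apply_ne δ hcd.symm) hkl hdj (ne_of_apply_ne δ hbc) hbl hbj hcl' hcj hlj)
        rfl rfl rfl rfl hid hib hic hbd.symm hcd.symm hbc (Or.inr hsum')
    -- none of `b, c, d` is `k`: all three are `m` or `n` — impossible (distinct values)
    rcases hmem b hbj hbl with hb' | hb' | hb' | hb'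
    · exact hbi hb'
    · exact hbk hb'
    · rcases hmem c hcj hcl' with hc' | hc' | hc' | hc'
      · exact hci hc'
      · exact hck hc'
      · exact hbc (by rw [hb', hc'])
      · rcases hmem d hdj hdl with hd' | hd' | hd' | hd'
        · exact hdi hd'
        · exact hdk hd'
        · exact hbd (by rw [hb', hd'])
        · exact hcd (by rw [hc', hd'])
    · rcases hmem c hcj hcl' with hc' | hc' | hc' | hc'
      · exact hci hc'
      · exact hck hc'
      · rcases hmem d hdj hdl with hd' | hd' | hd' | hd'
        · exact hdi hd'
        · exact hdk hd'
        · exact hcd (by rw [hc', hd'])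
        · exact hbd (by rw [hb', hd'])
      · exact hbc (by rw [hb', hc'])
  -- (6) dispatch on where `i` sits among `a, b, c, d` (it must: else four distinct values among `k, m, n`)
  by_cases hia : a = i
  · subst hia
    exact finish b c d hbj hbl hcj hcl' hdj hdl hab hac had hbc hbd hcd hsum
  by_cases hib : b = i
  · subst hib
    exact finish a c d haj hal hcj hcl' hdj hdl hab.symm hbc hbd hac had hcd (by linarith)
  by_cases hic : c = i
  · subst hic
    exact finish d a b hdj hdl haj hal hbj hbl hcd hac.symm hbc.symm had.symm hbd.symm hab (by linarith)
  by_cases hid : d = i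
  · subst hid
    exact finish c a b hcj hcl' haj hal hbj hbl hcd.symm had.symm hbd.symm hac.symm hbc.symm hab (by linarith)
  -- `a, b, c, d ∈ {k, m, n}` with four distinct values: pigeonhole
  rcases hmem a haj hal with ha' | ha' | ha' | ha'
  · exact hia ha'
  · rcases hmem b hbj hbl with hb' | hb' | hb' | hb'
    · exact hib hb'
    · exact hab (by rw [ha', hb'])
    · rcases hmem c hcj hcl' with hc' | hc' | hc' | hc'
      · exact hic hc'
      · exact hac (by rw [ha', hc'])
      · exact hbc (by rw [hb', hc'])
      · rcases hmem d hdj hdl with hd' | hd' | hd' | hd'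
        · exact hid hd'
        · exact had (by rw [ha', hd'])
        · exact hbd (by rw [hb', hd'])
        · exact hcd (by rw [hc', hd'])
    · rcases hmem c hcj hcl' with hc' | hc' | hc' | hc'
      · exact hic hc'
      · exact hac (by rw [ha', hc'])
      · rcases hmem d hdj hdl with hd' | hd' | hd' | hd'
        · exact hid hd'
        · exact had (by rw [ha', hd'])
        · exact hcd (by rw [hc', hd'])
        · exact hbd (by rw [hb', hd'])
      · exact hbc (by rw [hb', hc'])
  · rcases hmem b hbj hbl with hb' | hb' | hb' | hb'
    · exact hib hb'
    · rcases hmem c hcj hcl' with hc' | hc' | hc' | hc'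
      · exact hic hc'
      · exact hbc (by rw [hb', hc'])
      · exact hac (by rw [ha', hc'])
      · rcases hmem d hdj hdl with hd' | hd' | hd' | hd'
        · exact hid hd'
        · exact hbd (by rw [hb', hd'])
        · exact had (by rw [ha', hd'])
        · exact hcd (by rw [hc', hd'])
    · exact hab (by rw [ha', hb'])
    · rcases hmem c hcj hcl' with hc' | hc' | hc' | hc'
      · exact hic hc'
      · rcases hmem d hdj hdl with hd' | hd' | hd' | hd'
        · exact hid hd'
        · exact hcd (by rw [hc', hd'])
        · exact had (by rw [ha', hd'])
        · exact hbd (by rw [hb', hd'])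
      · exact hac (by rw [ha', hc'])
      · exact hbc (by rw [hb', hc'])
  · rcases hmem b hbj hbl with hb' | hb' | hb' | hb'
    · exact hib hb'
    · rcases hmem c hcj hcl' with hc' | hc' | hc' | hc'
      · exact hic hc'
      · exact hbc (by rw [hb', hc'])
      · rcases hmem d hdj hdl with hd' | hd' | hd' | hd'
        · exact hid hd'
        · exact hbd (by rw [hb', hd'])
        · exact hcd (by rw [hc', hd'])
        · exact had (by rw [ha', hd'])
      · exact hac (by rw [ha', hc'])
    · rcases hmem c hcj hcl' with hc' | hc' | hc' | hc'
      · exact hic hc'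
      · rcases hmem d hdj hdl with hd' | hd' | hd' | hd'
        · exact hid hd'
        · exact hcd (by rw [hc', hd'])
        · exact hbd (by rw [hb', hd'])
        · exact had (by rw [ha', hd'])
      · exact hbc (by rw [hb', hc'])
      · exact hac (by rw [ha', hc'])
    · exact hab (by rw [ha', hb'])

end Summit.ValiantsHypothesis.ValiantsHypothesis.Theorems.LacunarySymmetroidMatrixDescartes.WallBubbling
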